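import Summits.QuantumFields.YangMills.Theorems.PoincareLipschitzLeungXinGraphStabilitySlack
import Summits.QuantumFields.YangMills.Theorems.PoincareLipschitzLeungXinBoxCaccioppoli
import HarnessLib

/-!
# Crux `HistoryTailL` (stmt-QuantumFields-19936), K2 organ of record `hImproveCoreFlat` (FROZEN v1 bac8eda3) — supplier side, (S)-SLACK FLAT:
# THE LEUNG–XIN GRAPH STABILITY INEQUALITY FOR δ-ALMOST-MINIMISERS (✓`graph_stability` plus an ENERGY∕CAPACITY-type error)

Cell `ym3-torus` (YM ladder rung R3 = continuum SU(2) Yang–Mills on the three-torus — a RUNG, NOT the Clay problem); width seat `ym-ust-19936-w2` gen 12 (LEAD w1 g9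
2026-08-29T09:18:48Z «(S)-SLACK GO»; this is the flat∕untwisted corollary of ✓`PoincareLipschitzLeungXinGraphStabilitySlack` §2, split off by the 400-line rule).
THEOREMS ONLY, def-free; imports ✓`…GraphStabilitySlack` (✓p712185) + ✓`…LeungXinBoxCaccioppoli` (`dot_le_one`).  Summing ✓`sum_hessianForm_le_of_forall_dot_le_add`
over the four Leung–Xin fields with ✓`sum_bondHessian_eq` ∕ ✓`sum_secondVariation_eq` ∕ ✓`sum_tang_dot_tang` ∕ ✓`sum_tang_normSq` (LEAD g8's letters):
* ★★★ `graph_stability_slack` — `u : V → S³` unit, `η_x² ≤ 1`, slack `σ` along every Leung–Xin curve ⟹ ∀ `0 < |t| ≤ 1`: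
  `Σ_b η_xη_y e_b(1 + e_b∕2) ≤ 3Σ_b c_b(η_x − η_y)² + 8σ∕t² + 3t²·Σ_b [3(1 − c_b)(η_x² + η_y²) + (3(η_x² + η_y²) − 2η_xη_y(2 + c_b²))]`
  (the last bracket `= 3(η_x − η_y)² + 2η_xη_y(1 − c_b²)`: CAPACITY + ENERGY type — at a box of radius `ρ` with `E ≤ Λ₀ρ` the optimal `t` costs
  `≍ ρ√(σ(Λ₀+1)∕ρ) = ρ√(δ(Λ₀+1))` under the flat organ's slack `σ ≍ δρ`).
* ★★★ `stability_caccioppoli_box_slack` (v1.1) — ✓`stability_caccioppoli_box` for δ-almost-minimisers: `Σ_{b⊂Q_ρ} e_b(1+e_b∕2) ≤ 3·cap + 8σ∕t² + 3t²(3·cap + 5E(T))`,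
  `cap = 2d(2(ρ+s)+1)^d∕s²` (any cutoff `0 ≤ η ≤ 1` in the hypothesis).
HONEST SCOPE.  Finite-dimensional algebra; nothing of `hImproveCoreFlat`, `HistoryTailL` or a summit statement is proved; YM₃ on T³ is rung R3, NOT Clay.
[cite: Xin1980, p.609–613; SchoenUhlenbeck1982, §2; Giaquinta1984, Ch. III §2 p.77]
-/

set_option autoImplicit false

open scoped BigOperators
open Finset

namespace Summit.QuantumFields.YangMills.Theorems.PoincareLipschitzLeungXinGraphStabilitySlackFlat

open Summit.QuantumFields.YangMills.Theorems.PoincareLipschitzLeungXinSphereIdentity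
  (sum_bondHessian_eq sum_secondVariation_eq sum_tang_dot_tang sum_tang_normSq tang_normSq)
open Literature.MathematicalPhysics.QuantumFieldTheory.Balaban1983to89.B4Eq19LatticeOperators (Zd box unitVec box_mono)
open Literature.MathematicalPhysics.QuantumFieldTheory.Balaban1983to89.B4Eq19LatticeCaccioppoli (exists_cutoff)
open Summit.QuantumFields.YangMills.Theorems.PoincareLipschitzLeungXinBoxCaccioppoli (dot_le_one sum_sq_sub_cutoff_le)
open Summit.QuantumFields.YangMills.Theorems.PoincareLipschitzLeungXinGraphStabilitySlack (sum_hessianForm_le_of_forall_dot_le_add)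

/-! ## The flat graph stability inequality for almost-minimisers -/

/-- ★★★ **GRAPH STABILITY WITH AN ADDITIVE SLACK** (✓`graph_stability` for δ-ALMOST-minimisers).  `u : V → S³ ⊂ ℝ⁴` unit, `η : V → ℝ` with `η_x² ≤ 1`; if for each
coordinate field `a` and EVERY `t` the varied correlations along the Leung–Xin curve exceed the unvaried ones by at most `σ`, then for every `0 < |t| ≤ 1`:
`Σ_b η_xη_y·e_b·(1 + e_b∕2) ≤ 3·Σ_b c_b·(η_x − η_y)² + 8σ∕t² + 3t²·Σ_b [3(1 − c_b)(η_x² + η_y²) + (3(η_x² + η_y²) − 2η_xη_y(2 + c_b²))]`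
(`e_b = |u_x − u_y|²`, `c_b = u_x·u_y`; the last bracket is `3(η_x − η_y)² + 2η_xη_y(1 − c_b²)` — capacity + energy type).  Summed from §2 over the four fields
with ✓`sum_bondHessian_eq` ∕ ✓`sum_secondVariation_eq` ∕ ✓`sum_tang_dot_tang` ∕ ✓`sum_tang_normSq`. [cite: Xin1980, p.609–613; SchoenUhlenbeck1982, §2] -/
theorem graph_stability_slack {V B : Type*} [Fintype B] (src tgt : B → V) (u : V → Fin 4 → ℝ) (hu : ∀ x, dotProduct (u x) (u x) = 1)
    (η : V → ℝ) (hη : ∀ x, η x ^ 2 ≤ 1) {σ : ℝ}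
    (hmin : ∀ (a : Fin 4) (t : ℝ),
      ∑ b, dotProduct
        ((Real.sqrt (1 + t ^ 2 * dotProduct (η (src b) • (Pi.single a 1 - dotProduct (Pi.single a 1) (u (src b)) • u (src b)))
            (η (src b) • (Pi.single a 1 - dotProduct (Pi.single a 1) (u (src b)) • u (src b)))))⁻¹ •
          (u (src b) + t • (η (src b) • (Pi.single a 1 - dotProduct (Pi.single a 1) (u (src b)) • u (src b)))))
        ((Real.sqrt (1 + t ^ 2 * dotProduct (η (tgt b) • (Pi.single a 1 - dotProduct (Pi.single a 1) (u (tgt b)) • u (tgt b)))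
            (η (tgt b) • (Pi.single a 1 - dotProduct (Pi.single a 1) (u (tgt b)) • u (tgt b)))))⁻¹ •
          (u (tgt b) + t • (η (tgt b) • (Pi.single a 1 - dotProduct (Pi.single a 1) (u (tgt b)) • u (tgt b))))) ≤
      (∑ b, dotProduct (u (src b)) (u (tgt b))) + σ)
    {t : ℝ} (ht : t ≠ 0) (ht1 : t ^ 2 ≤ 1) :
    ∑ b, η (src b) * η (tgt b) * (dotProduct (u (src b) - u (tgt b)) (u (src b) - u (tgt b)) *
        (1 + dotProduct (u (src b) - u (tgt b)) (u (src b) - u (tgt b)) / 2)) ≤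
      3 * ∑ b, dotProduct (u (src b)) (u (tgt b)) * (η (src b) - η (tgt b)) ^ 2 + 8 * σ / t ^ 2 +
        3 * t ^ 2 * ∑ b, (3 * (1 - dotProduct (u (src b)) (u (tgt b))) * (η (src b) ^ 2 + η (tgt b) ^ 2) +
          (3 * (η (src b) ^ 2 + η (tgt b) ^ 2) - 2 * η (src b) * η (tgt b) * (2 + dotProduct (u (src b)) (u (tgt b)) ^ 2))) := by
  -- size rows for §2
  have htn : ∀ (a : Fin 4) (x : V), dotProduct (η x • (Pi.single a 1 - dotProduct (Pi.single a 1) (u x) • u x))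
      (η x • (Pi.single a 1 - dotProduct (Pi.single a 1) (u x) • u x)) ≤ 1 := by
    intro a x
    rw [smul_dotProduct, dotProduct_smul, smul_eq_mul, smul_eq_mul, tang_normSq a (u x) (hu x)]
    have h1 : 0 ≤ 1 - u x a * u x a := by rw [← tang_normSq a (u x) (hu x)]; exact Finset.sum_nonneg fun i _ => mul_self_nonneg _
    have h2 : 1 - u x a * u x a ≤ 1 := by nlinarith [mul_self_nonneg (u x a)]
    calc η x * (η x * (1 - u x a * u x a)) = η x ^ 2 * (1 - u x a * u x a) := by ring
      _ ≤ 1 * 1 := mul_le_mul (hη x) h2 h1 zero_le_one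
      _ = 1 := one_mul _
  -- Step 1: per field, §2's Hessian form with slack
  have hfield : ∀ a : Fin 4,
      ∑ b, (2 * dotProduct (η (src b) • (Pi.single a 1 - dotProduct (Pi.single a 1) (u (src b)) • u (src b)))
              (η (tgt b) • (Pi.single a 1 - dotProduct (Pi.single a 1) (u (tgt b)) • u (tgt b))) -
            dotProduct (u (src b)) (u (tgt b)) *
              (dotProduct (η (src b) • (Pi.single a 1 - dotProduct (Pi.single a 1) (u (src b)) • u (src b)))
                  (η (src b) • (Pi.single a 1 - dotProduct (Pi.single a 1) (u (src b)) • u (src b))) +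
                dotProduct (η (tgt b) • (Pi.single a 1 - dotProduct (Pi.single a 1) (u (tgt b)) • u (tgt b)))
                  (η (tgt b) • (Pi.single a 1 - dotProduct (Pi.single a 1) (u (tgt b)) • u (tgt b))))) ≤
        2 * σ / t ^ 2 + 3 * t ^ 2 * ∑ b,
          ((1 - dotProduct (u (src b)) (u (tgt b))) *
              (dotProduct (η (src b) • (Pi.single a 1 - dotProduct (Pi.single a 1) (u (src b)) • u (src b)))
                  (η (src b) • (Pi.single a 1 - dotProduct (Pi.single a 1) (u (src b)) • u (src b))) +
                dotProduct (η (tgt b) • (Pi.single a 1 - dotProduct (Pi.single a 1) (u (tgt b)) • u (tgt b)))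
                  (η (tgt b) • (Pi.single a 1 - dotProduct (Pi.single a 1) (u (tgt b)) • u (tgt b)))) +
            (dotProduct (η (src b) • (Pi.single a 1 - dotProduct (Pi.single a 1) (u (src b)) • u (src b)))
                  (η (src b) • (Pi.single a 1 - dotProduct (Pi.single a 1) (u (src b)) • u (src b))) +
                dotProduct (η (tgt b) • (Pi.single a 1 - dotProduct (Pi.single a 1) (u (tgt b)) • u (tgt b)))
                  (η (tgt b) • (Pi.single a 1 - dotProduct (Pi.single a 1) (u (tgt b)) • u (tgt b))) -
              2 * dotProduct (η (src b) • (Pi.single a 1 - dotProduct (Pi.single a 1) (u (src b)) • u (src b)))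
                (η (tgt b) • (Pi.single a 1 - dotProduct (Pi.single a 1) (u (tgt b)) • u (tgt b))))) :=
    fun a => sum_hessianForm_le_of_forall_dot_le_add Finset.univ (fun b => u (src b)) (fun b => u (tgt b))
      (fun b => η (src b) • (Pi.single a 1 - dotProduct (Pi.single a 1) (u (src b)) • u (src b)))
      (fun b => η (tgt b) • (Pi.single a 1 - dotProduct (Pi.single a 1) (u (tgt b)) • u (tgt b))) (hmin a)
      (fun b _ => dot_le_one (hu _) (hu _)) (fun b _ => htn a (src b)) (fun b _ => htn a (tgt b)) ht ht1
  -- Step 2: sum over the four fields; per bond the sphere identities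
  have hsum4 := Finset.sum_le_sum fun a (_ : a ∈ (Finset.univ : Finset (Fin 4))) => hfield a
  rw [Finset.sum_comm] at hsum4
  have hperL : ∀ b, ∑ a : Fin 4,
      (2 * dotProduct (η (src b) • (Pi.single a 1 - dotProduct (Pi.single a 1) (u (src b)) • u (src b)))
          (η (tgt b) • (Pi.single a 1 - dotProduct (Pi.single a 1) (u (tgt b)) • u (tgt b))) -
        dotProduct (u (src b)) (u (tgt b)) *
          (dotProduct (η (src b) • (Pi.single a 1 - dotProduct (Pi.single a 1) (u (src b)) • u (src b)))
              (η (src b) • (Pi.single a 1 - dotProduct (Pi.single a 1) (u (src b)) • u (src b))) +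
            dotProduct (η (tgt b) • (Pi.single a 1 - dotProduct (Pi.single a 1) (u (tgt b)) • u (tgt b)))
              (η (tgt b) • (Pi.single a 1 - dotProduct (Pi.single a 1) (u (tgt b)) • u (tgt b))))) =
      2 * η (src b) * η (tgt b) * (2 + dotProduct (u (src b)) (u (tgt b)) ^ 2) -
        3 * dotProduct (u (src b)) (u (tgt b)) * (η (src b) ^ 2 + η (tgt b) ^ 2) := by
    intro b
    rw [← sum_bondHessian_eq (u (src b)) (u (tgt b)) (hu _) (hu _) (η (src b)) (η (tgt b))]
    refine Finset.sum_congr rfl fun a _ => ?_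
    simp only [smul_dotProduct, dotProduct_smul, smul_eq_mul]
    ring
  -- per bond the error sums: `Σ_a (A+B) = 3(η_x² + η_y²)`, `Σ_a k = η_xη_y(2 + c²)`
  have hA : ∀ (x : V), ∑ a : Fin 4, dotProduct (η x • (Pi.single a 1 - dotProduct (Pi.single a 1) (u x) • u x))
      (η x • (Pi.single a 1 - dotProduct (Pi.single a 1) (u x) • u x)) = 3 * η x ^ 2 := by
    intro x
    have : ∀ a : Fin 4, dotProduct (η x • (Pi.single a 1 - dotProduct (Pi.single a 1) (u x) • u x))
        (η x • (Pi.single a 1 - dotProduct (Pi.single a 1) (u x) • u x)) =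
        η x ^ 2 * dotProduct (Pi.single a 1 - dotProduct (Pi.single a 1) (u x) • u x) (Pi.single a 1 - dotProduct (Pi.single a 1) (u x) • u x) := by
      intro a; rw [smul_dotProduct, dotProduct_smul, smul_eq_mul, smul_eq_mul]; ring
    simp only [this]
    rw [← Finset.mul_sum, sum_tang_normSq (u x) (hu x)]; ring
  have hK : ∀ b, ∑ a : Fin 4, dotProduct (η (src b) • (Pi.single a 1 - dotProduct (Pi.single a 1) (u (src b)) • u (src b)))
      (η (tgt b) • (Pi.single a 1 - dotProduct (Pi.single a 1) (u (tgt b)) • u (tgt b))) =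
      η (src b) * η (tgt b) * (2 + dotProduct (u (src b)) (u (tgt b)) ^ 2) := by
    intro b
    have : ∀ a : Fin 4, dotProduct (η (src b) • (Pi.single a 1 - dotProduct (Pi.single a 1) (u (src b)) • u (src b)))
        (η (tgt b) • (Pi.single a 1 - dotProduct (Pi.single a 1) (u (tgt b)) • u (tgt b))) =
        η (src b) * η (tgt b) * dotProduct (Pi.single a 1 - dotProduct (Pi.single a 1) (u (src b)) • u (src b))
          (Pi.single a 1 - dotProduct (Pi.single a 1) (u (tgt b)) • u (tgt b)) := by
      intro a; rw [smul_dotProduct, dotProduct_smul, smul_eq_mul, smul_eq_mul]; ring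
    simp only [this]
    rw [← Finset.mul_sum, sum_tang_dot_tang (u (src b)) (u (tgt b)) (hu _) (hu _)]
  have hperR : ∀ b, ∑ a : Fin 4,
      ((1 - dotProduct (u (src b)) (u (tgt b))) *
          (dotProduct (η (src b) • (Pi.single a 1 - dotProduct (Pi.single a 1) (u (src b)) • u (src b)))
              (η (src b) • (Pi.single a 1 - dotProduct (Pi.single a 1) (u (src b)) • u (src b))) +
            dotProduct (η (tgt b) • (Pi.single a 1 - dotProduct (Pi.single a 1) (u (tgt b)) • u (tgt b)))
              (η (tgt b) • (Pi.single a 1 - dotProduct (Pi.single a 1) (u (tgt b)) • u (tgt b)))) +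
        (dotProduct (η (src b) • (Pi.single a 1 - dotProduct (Pi.single a 1) (u (src b)) • u (src b)))
              (η (src b) • (Pi.single a 1 - dotProduct (Pi.single a 1) (u (src b)) • u (src b))) +
            dotProduct (η (tgt b) • (Pi.single a 1 - dotProduct (Pi.single a 1) (u (tgt b)) • u (tgt b)))
              (η (tgt b) • (Pi.single a 1 - dotProduct (Pi.single a 1) (u (tgt b)) • u (tgt b))) -
          2 * dotProduct (η (src b) • (Pi.single a 1 - dotProduct (Pi.single a 1) (u (src b)) • u (src b)))
            (η (tgt b) • (Pi.single a 1 - dotProduct (Pi.single a 1) (u (tgt b)) • u (tgt b))))) =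
      3 * (1 - dotProduct (u (src b)) (u (tgt b))) * (η (src b) ^ 2 + η (tgt b) ^ 2) +
        (3 * (η (src b) ^ 2 + η (tgt b) ^ 2) - 2 * η (src b) * η (tgt b) * (2 + dotProduct (u (src b)) (u (tgt b)) ^ 2)) := by
    intro b
    rw [Finset.sum_add_distrib, ← Finset.mul_sum, Finset.sum_add_distrib, hA, hA, Finset.sum_sub_distrib, Finset.sum_add_distrib, hA, hA,
      ← Finset.mul_sum, hK]
    ring
  simp only [hperL] at hsum4
  rw [Finset.sum_add_distrib, Finset.sum_const, Finset.card_univ, Fintype.card_fin, ← Finset.mul_sum, Finset.sum_comm] at hsum4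
  simp only [hperR, nsmul_eq_mul, Nat.cast_ofNat] at hsum4
  -- Step 3: convert with the second-variation form (= −2 × the Hessian sum)
  have hsplitL : ∑ b, (2 * η (src b) * η (tgt b) * (2 + dotProduct (u (src b)) (u (tgt b)) ^ 2) -
        3 * dotProduct (u (src b)) (u (tgt b)) * (η (src b) ^ 2 + η (tgt b) ^ 2)) =
      -(1 / 2) * ∑ b, (6 * dotProduct (u (src b)) (u (tgt b)) * (η (src b) - η (tgt b)) ^ 2 -
        2 * η (src b) * η (tgt b) * dotProduct (u (src b) - u (tgt b)) (u (src b) - u (tgt b)) *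
          (1 + dotProduct (u (src b) - u (tgt b)) (u (src b) - u (tgt b)) / 2)) := by
    rw [Finset.mul_sum]
    refine Finset.sum_congr rfl fun b _ => ?_
    rw [← sum_bondHessian_eq (u (src b)) (u (tgt b)) (hu _) (hu _), ← sum_secondVariation_eq (u (src b)) (u (tgt b)) (hu _) (hu _)]
    ring
  rw [hsplitL] at hsum4
  have hsplit2 : ∑ b, (6 * dotProduct (u (src b)) (u (tgt b)) * (η (src b) - η (tgt b)) ^ 2 -
      2 * η (src b) * η (tgt b) * dotProduct (u (src b) - u (tgt b)) (u (src b) - u (tgt b)) *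
        (1 + dotProduct (u (src b) - u (tgt b)) (u (src b) - u (tgt b)) / 2)) =
      2 * (3 * ∑ b, dotProduct (u (src b)) (u (tgt b)) * (η (src b) - η (tgt b)) ^ 2) -
        2 * ∑ b, η (src b) * η (tgt b) * (dotProduct (u (src b) - u (tgt b)) (u (src b) - u (tgt b)) *
          (1 + dotProduct (u (src b) - u (tgt b)) (u (src b) - u (tgt b)) / 2)) := by
    rw [Finset.mul_sum, Finset.mul_sum, Finset.mul_sum, ← Finset.sum_sub_distrib]
    refine Finset.sum_congr rfl fun b _ => ?_
    ring
  rw [hsplit2] at hsum4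
  have e4 : (4 : ℝ) * (2 * σ / t ^ 2) = 8 * σ / t ^ 2 := by ring
  linarith


/-! ## (v1.1 append) The stability Caccioppoli inequality on a box, for almost-minimisers -/

/-- ★★★ **THE STABILITY CACCIOPPOLI INEQUALITY ON A BOX OF `ℤ^d` FOR δ-ALMOST-MINIMISERS** (✓`stability_caccioppoli_box` with slack).  `T` a finite bond set,
`u : ℤ^d → S³` unit, `z`, `ρ ≥ 0`, `s ≥ 1`; if for EVERY cutoff `η` with `0 ≤ η ≤ 1` supported in `Q_{ρ+s}(z)`, every field `a` and every `t` the Leung–Xin-varied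
correlation on `T` exceeds the unvaried one by at most `σ`, then for every `0 < |t| ≤ 1`:
`Σ_{b∈T, b⊂Q_ρ(z)} e_b(1 + e_b∕2) ≤ 3·(2d(2(ρ+s)+1)^d)∕s² + 8σ∕t² + 3t²·(3·(2d(2(ρ+s)+1)^d)∕s² + 5·Σ_{b∈T} e_b)` — the error is the cutoff CAPACITY plus
the ENERGY of `T`, so at `ρ = s = R`, `E(T) ≤ Λ₀R` (d = 3) the optimal `t` costs `≍ R√(σ(Λ₀+1)∕R) ≍ R√(δ(Λ₀+1))` under the organ's slack `σ ≍ δR`.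
(`graph_stability_slack` at lit ✓`exists_cutoff`'s `χ`; `c_b ≤ 1`; `(χ_x²+χ_y²) ≤ 2`, `χ_xχ_y(1 − c_b²) ≤ 2(1 − c_b)`; ✓`sum_sq_sub_cutoff_le` twice.)
[cite: Xin1980, p.609–613; Giaquinta1984, Ch. III §2 p.77] -/
theorem stability_caccioppoli_box_slack {d : ℕ} (T : Finset (Zd d × Fin d)) (u : Zd d → Fin 4 → ℝ) (hu : ∀ x, dotProduct (u x) (u x) = 1)
    (z : Zd d) {ρ s : ℤ} (hρ : 0 ≤ ρ) (hs : 1 ≤ s) {σ : ℝ}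
    (hmin : ∀ η : Zd d → ℝ, (∀ y ∉ box z (ρ + s), η y = 0) → (∀ y, 0 ≤ η y) → (∀ y, η y ≤ 1) → ∀ (a : Fin 4) (t : ℝ),
      ∑ b ∈ T, dotProduct
        ((Real.sqrt (1 + t ^ 2 * dotProduct (η b.1 • (Pi.single a 1 - dotProduct (Pi.single a 1) (u b.1) • u b.1))
            (η b.1 • (Pi.single a 1 - dotProduct (Pi.single a 1) (u b.1) • u b.1))))⁻¹ •
          (u b.1 + t • (η b.1 • (Pi.single a 1 - dotProduct (Pi.single a 1) (u b.1) • u b.1))))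
        ((Real.sqrt (1 + t ^ 2 * dotProduct (η (b.1 + unitVec b.2) •
              (Pi.single a 1 - dotProduct (Pi.single a 1) (u (b.1 + unitVec b.2)) • u (b.1 + unitVec b.2)))
            (η (b.1 + unitVec b.2) • (Pi.single a 1 - dotProduct (Pi.single a 1) (u (b.1 + unitVec b.2)) • u (b.1 + unitVec b.2)))))⁻¹ •
          (u (b.1 + unitVec b.2) + t • (η (b.1 + unitVec b.2) •
            (Pi.single a 1 - dotProduct (Pi.single a 1) (u (b.1 + unitVec b.2)) • u (b.1 + unitVec b.2))))) ≤
      (∑ b ∈ T, dotProduct (u b.1) (u (b.1 + unitVec b.2))) + σ)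
    {t : ℝ} (ht : t ≠ 0) (ht1 : t ^ 2 ≤ 1) :
    ∑ b ∈ T.filter (fun b => b.1 ∈ box z ρ ∧ b.1 + unitVec b.2 ∈ box z ρ),
      dotProduct (u b.1 - u (b.1 + unitVec b.2)) (u b.1 - u (b.1 + unitVec b.2)) *
        (1 + dotProduct (u b.1 - u (b.1 + unitVec b.2)) (u b.1 - u (b.1 + unitVec b.2)) / 2) ≤
      3 * (2 * (d : ℝ) * ((2 * (ρ + s) + 1 : ℤ) : ℝ) ^ d) / (s : ℝ) ^ 2 + 8 * σ / t ^ 2 +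
        3 * t ^ 2 * (3 * (2 * (d : ℝ) * ((2 * (ρ + s) + 1 : ℤ) : ℝ) ^ d / (s : ℝ) ^ 2) +
          5 * ∑ b ∈ T, dotProduct (u b.1 - u (b.1 + unitVec b.2)) (u b.1 - u (b.1 + unitVec b.2))) := by
  classical
  obtain ⟨χ, hχ0, hχ1, hχin, hχout, hχlip⟩ := exists_cutoff z hρ hs
  have hχsq : ∀ x, χ x ^ 2 ≤ 1 := fun x => by nlinarith [hχ0 x, hχ1 x]
  -- `graph_stability_slack` on the finite graph `T` with the cutoff `χ`
  have hG := graph_stability_slack (B := ↥T) (fun b => b.1.1) (fun b => b.1.1 + unitVec b.1.2) u hu χ hχsq (σ := σ) (fun a t' => by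
    have h := hmin χ hχout hχ0 hχ1 a t'
    rw [← Finset.sum_coe_sort T] at h
    rw [← Finset.sum_coe_sort T] at h
    exact h) ht ht1
  rw [Finset.sum_coe_sort T (fun b => χ b.1 * χ (b.1 + unitVec b.2) *
      (dotProduct (u b.1 - u (b.1 + unitVec b.2)) (u b.1 - u (b.1 + unitVec b.2)) *
        (1 + dotProduct (u b.1 - u (b.1 + unitVec b.2)) (u b.1 - u (b.1 + unitVec b.2)) / 2))),
    Finset.sum_coe_sort T (fun b => dotProduct (u b.1) (u (b.1 + unitVec b.2)) * (χ b.1 - χ (b.1 + unitVec b.2)) ^ 2),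
    Finset.sum_coe_sort T (fun b => 3 * (1 - dotProduct (u b.1) (u (b.1 + unitVec b.2))) * (χ b.1 ^ 2 + χ (b.1 + unitVec b.2) ^ 2) +
      (3 * (χ b.1 ^ 2 + χ (b.1 + unitVec b.2) ^ 2) -
        2 * χ b.1 * χ (b.1 + unitVec b.2) * (2 + dotProduct (u b.1) (u (b.1 + unitVec b.2)) ^ 2)))] at hG
  -- nonnegativity of the energy terms
  have he0 : ∀ b : Zd d × Fin d, 0 ≤ dotProduct (u b.1 - u (b.1 + unitVec b.2)) (u b.1 - u (b.1 + unitVec b.2)) := fun b => by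
    simp only [dotProduct, Pi.sub_apply]
    exact Finset.sum_nonneg fun i _ => mul_self_nonneg _
  have hterm0 : ∀ b : Zd d × Fin d, 0 ≤ dotProduct (u b.1 - u (b.1 + unitVec b.2)) (u b.1 - u (b.1 + unitVec b.2)) *
      (1 + dotProduct (u b.1 - u (b.1 + unitVec b.2)) (u b.1 - u (b.1 + unitVec b.2)) / 2) := fun b =>
    mul_nonneg (he0 b) (by linarith [he0 b])
  -- LEFT: the bonds inside `Q_ρ(z)` carry `χ_x χ_y = 1`
  have hρ1 : box z ρ ⊆ box z (ρ + 1) := box_mono z (by linarith)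
  have hL : ∑ b ∈ T.filter (fun b => b.1 ∈ box z ρ ∧ b.1 + unitVec b.2 ∈ box z ρ),
      dotProduct (u b.1 - u (b.1 + unitVec b.2)) (u b.1 - u (b.1 + unitVec b.2)) *
        (1 + dotProduct (u b.1 - u (b.1 + unitVec b.2)) (u b.1 - u (b.1 + unitVec b.2)) / 2) ≤
      ∑ b ∈ T, χ b.1 * χ (b.1 + unitVec b.2) *
        (dotProduct (u b.1 - u (b.1 + unitVec b.2)) (u b.1 - u (b.1 + unitVec b.2)) *
          (1 + dotProduct (u b.1 - u (b.1 + unitVec b.2)) (u b.1 - u (b.1 + unitVec b.2)) / 2)) := by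
    calc ∑ b ∈ T.filter (fun b => b.1 ∈ box z ρ ∧ b.1 + unitVec b.2 ∈ box z ρ),
          dotProduct (u b.1 - u (b.1 + unitVec b.2)) (u b.1 - u (b.1 + unitVec b.2)) *
            (1 + dotProduct (u b.1 - u (b.1 + unitVec b.2)) (u b.1 - u (b.1 + unitVec b.2)) / 2)
        = ∑ b ∈ T.filter (fun b => b.1 ∈ box z ρ ∧ b.1 + unitVec b.2 ∈ box z ρ), χ b.1 * χ (b.1 + unitVec b.2) *
            (dotProduct (u b.1 - u (b.1 + unitVec b.2)) (u b.1 - u (b.1 + unitVec b.2)) *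
              (1 + dotProduct (u b.1 - u (b.1 + unitVec b.2)) (u b.1 - u (b.1 + unitVec b.2)) / 2)) := by
          refine Finset.sum_congr rfl fun b hb => ?_
          obtain ⟨_, hb1, hb2⟩ := Finset.mem_filter.1 hb
          rw [hχin _ (hρ1 hb1), hχin _ (hρ1 hb2), one_mul, one_mul]
      _ ≤ _ := by
          refine Finset.sum_le_sum_of_subset_of_nonneg (Finset.filter_subset _ T) fun b _ _ => ?_
          exact mul_nonneg (mul_nonneg (hχ0 _) (hχ0 _)) (hterm0 b)
  -- RIGHT 1: `c_b ≤ 1` and the cutoff's capacity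
  have hR : ∑ b ∈ T, dotProduct (u b.1) (u (b.1 + unitVec b.2)) * (χ b.1 - χ (b.1 + unitVec b.2)) ^ 2 ≤
      2 * (d : ℝ) * ((2 * (ρ + s) + 1 : ℤ) : ℝ) ^ d / (s : ℝ) ^ 2 :=
    sum_sq_sub_cutoff_le T z (by linarith) hs hχout hχlip (fun b => dotProduct (u b.1) (u (b.1 + unitVec b.2)))
      (fun b _ => dot_le_one (hu _) (hu _))
  -- RIGHT 2: the error is capacity + energy
  have hcap : ∑ b ∈ T, (1 : ℝ) * (χ b.1 - χ (b.1 + unitVec b.2)) ^ 2 ≤ 2 * (d : ℝ) * ((2 * (ρ + s) + 1 : ℤ) : ℝ) ^ d / (s : ℝ) ^ 2 :=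
    sum_sq_sub_cutoff_le T z (by linarith) hs hχout hχlip (fun _ => (1 : ℝ)) (fun _ _ => le_rfl)
  have hErr : ∀ b ∈ T, 3 * (1 - dotProduct (u b.1) (u (b.1 + unitVec b.2))) * (χ b.1 ^ 2 + χ (b.1 + unitVec b.2) ^ 2) +
      (3 * (χ b.1 ^ 2 + χ (b.1 + unitVec b.2) ^ 2) -
        2 * χ b.1 * χ (b.1 + unitVec b.2) * (2 + dotProduct (u b.1) (u (b.1 + unitVec b.2)) ^ 2)) ≤
      3 * ((1 : ℝ) * (χ b.1 - χ (b.1 + unitVec b.2)) ^ 2) +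
        5 * dotProduct (u b.1 - u (b.1 + unitVec b.2)) (u b.1 - u (b.1 + unitVec b.2)) := by
    intro b _
    have hc1 : dotProduct (u b.1) (u (b.1 + unitVec b.2)) ≤ 1 := dot_le_one (hu _) (hu _)
    have he : dotProduct (u b.1 - u (b.1 + unitVec b.2)) (u b.1 - u (b.1 + unitVec b.2)) = 2 - 2 * dotProduct (u b.1) (u (b.1 + unitVec b.2)) := by
      rw [sub_dotProduct, dotProduct_sub, dotProduct_sub, hu, hu, dotProduct_comm (u (b.1 + unitVec b.2)) (u b.1)]; ring
    rw [he]
    have hx0 := hχ0 b.1; have hx1 := hχ1 b.1; have hy0 := hχ0 (b.1 + unitVec b.2); have hy1 := hχ1 (b.1 + unitVec b.2)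
    set c := dotProduct (u b.1) (u (b.1 + unitVec b.2)) with hc
    set p := χ b.1 with hp
    set q := χ (b.1 + unitVec b.2) with hq
    have hpq : 0 ≤ p * q := mul_nonneg hx0 hy0
    have hpq1 : p * q ≤ 1 := by nlinarith
    -- `2pq(1 − c²) ≤ 4(1 − c)` since `(1 − c²) − 2(1 − c) = −(1 − c)² ≤ 0` and `0 ≤ pq ≤ 1`
    have h1 : 2 * p * q * (1 - c ^ 2) ≤ 4 * (1 - c) := by nlinarith [sq_nonneg (1 - c), mul_nonneg hpq (sq_nonneg (1 - c))]
    have hc0 : 0 ≤ 1 - c := by linarith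
    have hpq2 : p ^ 2 + q ^ 2 ≤ 2 := by nlinarith
    have h2 : (1 - c) * (p ^ 2 + q ^ 2) ≤ (1 - c) * 2 := mul_le_mul_of_nonneg_left hpq2 hc0
    have e : 3 * (p ^ 2 + q ^ 2) - 2 * p * q * (2 + c ^ 2) = 3 * (1 * (p - q) ^ 2) + 2 * p * q * (1 - c ^ 2) := by ring
    have e2 : 3 * (1 - c) * (p ^ 2 + q ^ 2) = 3 * ((1 - c) * (p ^ 2 + q ^ 2)) := by ring
    rw [e, e2]
    linarith
  have hErrSum : ∑ b ∈ T, (3 * (1 - dotProduct (u b.1) (u (b.1 + unitVec b.2))) * (χ b.1 ^ 2 + χ (b.1 + unitVec b.2) ^ 2) +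
      (3 * (χ b.1 ^ 2 + χ (b.1 + unitVec b.2) ^ 2) -
        2 * χ b.1 * χ (b.1 + unitVec b.2) * (2 + dotProduct (u b.1) (u (b.1 + unitVec b.2)) ^ 2))) ≤
      3 * (2 * (d : ℝ) * ((2 * (ρ + s) + 1 : ℤ) : ℝ) ^ d / (s : ℝ) ^ 2) +
        5 * ∑ b ∈ T, dotProduct (u b.1 - u (b.1 + unitVec b.2)) (u b.1 - u (b.1 + unitVec b.2)) := by
    calc _ ≤ ∑ b ∈ T, (3 * ((1 : ℝ) * (χ b.1 - χ (b.1 + unitVec b.2)) ^ 2) +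
          5 * dotProduct (u b.1 - u (b.1 + unitVec b.2)) (u b.1 - u (b.1 + unitVec b.2))) := Finset.sum_le_sum hErr
      _ = 3 * ∑ b ∈ T, (1 : ℝ) * (χ b.1 - χ (b.1 + unitVec b.2)) ^ 2 +
          5 * ∑ b ∈ T, dotProduct (u b.1 - u (b.1 + unitVec b.2)) (u b.1 - u (b.1 + unitVec b.2)) := by
          rw [Finset.sum_add_distrib, Finset.mul_sum, Finset.mul_sum]
      _ ≤ _ := by linarith
  have ht2 : 0 ≤ 3 * t ^ 2 := by positivity
  have hE3 := mul_le_mul_of_nonneg_left hErrSum ht2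
  have hR3 := mul_le_mul_of_nonneg_left hR (by norm_num : (0 : ℝ) ≤ 3)
  have key : 3 * ∑ b ∈ T, dotProduct (u b.1) (u (b.1 + unitVec b.2)) * (χ b.1 - χ (b.1 + unitVec b.2)) ^ 2 + 8 * σ / t ^ 2 +
      3 * t ^ 2 * ∑ b ∈ T, (3 * (1 - dotProduct (u b.1) (u (b.1 + unitVec b.2))) * (χ b.1 ^ 2 + χ (b.1 + unitVec b.2) ^ 2) +
        (3 * (χ b.1 ^ 2 + χ (b.1 + unitVec b.2) ^ 2) -
          2 * χ b.1 * χ (b.1 + unitVec b.2) * (2 + dotProduct (u b.1) (u (b.1 + unitVec b.2)) ^ 2))) ≤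
      3 * (2 * (d : ℝ) * ((2 * (ρ + s) + 1 : ℤ) : ℝ) ^ d / (s : ℝ) ^ 2) + 8 * σ / t ^ 2 +
        3 * t ^ 2 * (3 * (2 * (d : ℝ) * ((2 * (ρ + s) + 1 : ℤ) : ℝ) ^ d / (s : ℝ) ^ 2) +
          5 * ∑ b ∈ T, dotProduct (u b.1 - u (b.1 + unitVec b.2)) (u b.1 - u (b.1 + unitVec b.2))) :=
    add_le_add (add_le_add hR3 le_rfl) hE3
  calc _ ≤ _ := hL
    _ ≤ _ := hG
    _ ≤ _ := key
    _ = _ := by ring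

end Summit.QuantumFields.YangMills.Theorems.PoincareLipschitzLeungXinGraphStabilitySlackFlat
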